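import Mathlib

/-!
# Route BarrierLever — item `PartitionMinorsHitByVP` (stmt-ValiantsHypothesis-19717):
# the TWO-BLOCK TROPICAL LEMMA (part 1 of the bi-threshold door D-THR)

Helper file (`--supports stmt-ValiantsHypothesis-19717`; cell valiant-natproofs, rung V4, 𝒟-side,
prover seat valiant-natproofs-prover gen 6). Pure linear algebra over `ℂ[X]`, definition-free.
Closes NO item.

Context (memo `HOME/prover/gen6/ADAPTIVE-WITNESSES-MEMO-g6.md` §5–§7): a sum of TWO product states
`P_X + Q` whose `P`-part is scaled by `X^{d(i,j)}` exposes, at the top `X`-degree of the layout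
determinant, the product of the two cell determinants `det P[S,T] · det Q[Sᶜ,Tᶜ]` of a bi-threshold
split; the census (kit j253355/j253364/j253366/j253367, h = 3 exhaustive) finds such a split with
both cells nonsingular for EVERY layout tested. This file is the algebraic half of that door:

* `coeff_prod_of_natDegree_le_sum` — coefficient of a product at the sum of entrywise degree bounds.
* `det_fromBlocks_of_split_ne_zero` — the block matrix `G = [p on S×T, q on Sᶜ×Tᶜ, 0 elsewhere]`
  is nonsingular when both blocks are (bijections `e : S ≃ T`, `e' : Sᶜ ≃ Tᶜ` given).
* **`det_ne_zero_of_twoBlock`** — for `A(i,j) = C(p i j)·X^{d i j} + C(q i j)·X^{c₀}` with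
  `d i j ≠ c₀`, `(c₀ < d i j ↔ i ∈ S)`, and a degree budget `N` attained exactly by the
  block-compatible permutations (`σ j ∈ S ↔ j ∈ T`) and strictly missed by all others, the
  coefficient of `X^N` in `det A` is `det G`; hence `det G ≠ 0 ⇒ det A ≠ 0`.

WHAT THIS IS NOT: the instantiation (threshold weights `d = C₀ + L·a_i + b_j`, product-state
realisation, `SmallCircuits` membership) is part 2; no layout is certified here; nothing on crux 14610.
-/

set_option linter.dupNamespace false

namespace Summit.ValiantsHypothesis.ValiantsHypothesis.Theorems.BarrierLever.TwoBlock

open Finset Polynomial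

/-! ## 1. Coefficients of products at the degree budget -/

/-- The coefficient of `∏ f i` at `Σ n i` is `∏ (f i).coeff (n i)` when `natDegree (f i) ≤ n i`. -/
theorem coeff_prod_of_natDegree_le_sum {ι : Type*} (s : Finset ι) (f : ι → ℂ[X]) (n : ι → ℕ)
    (h : ∀ i ∈ s, (f i).natDegree ≤ n i) :
    (∏ i ∈ s, f i).coeff (∑ i ∈ s, n i) = ∏ i ∈ s, (f i).coeff (n i) := by
  classical
  induction s using Finset.induction_on with
  | empty => simp
  | insert a s ha ih =>
    rw [Finset.prod_insert ha, Finset.sum_insert ha, Finset.prod_insert ha,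
      Polynomial.coeff_mul_add_eq_of_natDegree_le (h a (Finset.mem_insert_self a s))
        ((Polynomial.natDegree_prod_le _ _).trans
          (Finset.sum_le_sum fun i hi => h i (Finset.mem_insert_of_mem hi))),
      ih fun i hi => h i (Finset.mem_insert_of_mem hi)]

/-- Degree bound of a two-term entry `C p · X^d + C q · X^c₀`. -/
theorem natDegree_entry_le (p q : ℂ) (d c₀ : ℕ) :
    (C p * X ^ d + C q * X ^ c₀ : ℂ[X]).natDegree ≤ max d c₀ :=
  (natDegree_add_le _ _).trans
    (max_le_max (natDegree_C_mul_X_pow_le _ _) (natDegree_C_mul_X_pow_le _ _))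

/-- Top coefficient of a two-term entry with distinct exponents. -/
theorem coeff_entry_max (p q : ℂ) (d c₀ : ℕ) (hd : d ≠ c₀) :
    (C p * X ^ d + C q * X ^ c₀ : ℂ[X]).coeff (max d c₀) = if c₀ < d then p else q := by
  rw [coeff_add, coeff_C_mul_X_pow, coeff_C_mul_X_pow]
  rcases lt_or_gt_of_ne hd with h | h
  · -- d < c₀ : top = c₀, coefficient q
    rw [max_eq_right h.le, if_neg (ne_of_gt h), if_pos rfl, if_neg (not_lt.mpr h.le), zero_add]
  · -- c₀ < d : top = d, coefficient p
    rw [max_eq_left h.le, if_pos rfl, if_neg (ne_of_gt h), if_pos h, add_zero]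

/-! ## 2. The block matrix of a split -/

variable {r : ℕ}

/-- **Block determinant.** If `p` is nonsingular on `S × T` (through a bijection `e : S ≃ T`) and
`q` on `Sᶜ × Tᶜ` (through `e'`), then the matrix `G` agreeing with `p` on `S × T`, with `q` on
`Sᶜ × Tᶜ` and `0` elsewhere is nonsingular. -/
theorem det_fromBlocks_of_split_ne_zero (p q : Matrix (Fin r) (Fin r) ℂ) (S T : Finset (Fin r))
    (e : {i // i ∈ S} ≃ {j // j ∈ T}) (e' : {i // i ∉ S} ≃ {j // j ∉ T})
    (hp : (Matrix.of fun i i' : {i // i ∈ S} => p i (e i')).det ≠ 0)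
    (hq : (Matrix.of fun i i' : {i // i ∉ S} => q i (e' i')).det ≠ 0) :
    (Matrix.of fun i j : Fin r =>
      if i ∈ S then (if j ∈ T then p i j else 0) else (if j ∈ T then 0 else q i j)).det ≠ 0 := by
  classical
  set G : Matrix (Fin r) (Fin r) ℂ := Matrix.of fun i j : Fin r =>
      if i ∈ S then (if j ∈ T then p i j else 0) else (if j ∈ T then 0 else q i j) with hG
  -- column permutation sending `S` to `T` along `e` and `Sᶜ` to `Tᶜ` along `e'`
  let κ : Equiv.Perm (Fin r) :=
    (Equiv.sumCompl (fun i : Fin r => i ∈ S)).symm.trans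
      ((e.sumCongr e').trans (Equiv.sumCompl (fun j : Fin r => j ∈ T)))
  have hκS : ∀ i : {i // i ∈ S}, κ i = e i := fun i => by
    simp [κ, Equiv.sumCompl_symm_apply_of_pos i.2]
  have hκS' : ∀ i : {i // i ∉ S}, κ i = e' i := fun i => by
    simp [κ, Equiv.sumCompl_symm_apply_of_neg i.2]
  -- H = G with permuted columns, reindexed by S ⊕ Sᶜ, is block diagonal
  set H : Matrix (Fin r) (Fin r) ℂ := G.submatrix id κ with hH
  have hdetH : H.det = Equiv.Perm.sign κ * G.det := by
    rw [hH, Matrix.det_permute']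
  let eS := (Equiv.sumCompl (fun i : Fin r => i ∈ S)).symm
  have hblocks : H.reindex eS eS =
      Matrix.fromBlocks (Matrix.of fun i i' : {i // i ∈ S} => p i (e i')) 0 0
        (Matrix.of fun i i' : {i // i ∉ S} => q i (e' i')) := by
    ext x y
    rw [Matrix.reindex_apply, Matrix.submatrix_apply]
    rcases x with x | x <;> rcases y with y | y
    · simp only [eS, Equiv.symm_symm, Equiv.sumCompl_apply_inl, Matrix.fromBlocks_apply₁₁,
        Matrix.of_apply, hH, Matrix.submatrix_apply, id, hκS, hG]
      rw [if_pos x.2, if_pos (e y).2]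
    · simp only [eS, Equiv.symm_symm, Equiv.sumCompl_apply_inl, Equiv.sumCompl_apply_inr,
        Matrix.fromBlocks_apply₁₂, Matrix.zero_apply, hH, Matrix.submatrix_apply, id, hκS', hG,
        Matrix.of_apply]
      rw [if_pos x.2, if_neg (e' y).2]
    · simp only [eS, Equiv.symm_symm, Equiv.sumCompl_apply_inl, Equiv.sumCompl_apply_inr,
        Matrix.fromBlocks_apply₂₁, Matrix.zero_apply, hH, Matrix.submatrix_apply, id, hκS, hG,
        Matrix.of_apply]
      rw [if_neg x.2, if_pos (e y).2]
    · simp only [eS, Equiv.symm_symm, Equiv.sumCompl_apply_inr, Matrix.fromBlocks_apply₂₂,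
        Matrix.of_apply, hH, Matrix.submatrix_apply, id, hκS', hG]
      rw [if_neg x.2, if_neg (e' y).2]
  have hdetH' : (H.reindex eS eS).det = H.det := Matrix.det_reindex_self eS H
  rw [hblocks, Matrix.det_fromBlocks_zero₂₁] at hdetH'
  -- conclude
  intro hG0
  rw [hG0, mul_zero] at hdetH
  rw [hdetH] at hdetH'
  exact mul_ne_zero hp hq hdetH'

/-! ## 3. The two-block tropical lemma -/

/-- **Two-block tropical lemma.** Let `A(i,j) = C(p i j)·X^{d i j} + C(q i j)·X^{c₀}` with
`d i j ≠ c₀` and `c₀ < d i j ↔ i ∈ S`. Suppose the degree budget `N` bounds `Σ_j max (d (σ j) j) c₀`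
for every permutation `σ`, with equality when `σ` is block compatible (`σ j ∈ S ↔ j ∈ T` for all
`j`) and strict inequality otherwise. If the block matrix of `(p, q, S, T)` is nonsingular then
`det A ≠ 0` (its `X^N`-coefficient is that block determinant). -/
theorem det_ne_zero_of_twoBlock (p q : Matrix (Fin r) (Fin r) ℂ) (d : Fin r → Fin r → ℕ) (c₀ : ℕ)
    (S T : Finset (Fin r)) (hd : ∀ i j, d i j ≠ c₀) (hdS : ∀ i j, c₀ < d i j ↔ i ∈ S) (N : ℕ)
    (htop_eq : ∀ σ : Equiv.Perm (Fin r), (∀ j, σ j ∈ S ↔ j ∈ T) → ∑ j, max (d (σ j) j) c₀ = N)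
    (htop_lt : ∀ σ : Equiv.Perm (Fin r), ¬ (∀ j, σ j ∈ S ↔ j ∈ T) → ∑ j, max (d (σ j) j) c₀ < N)
    (hG : (Matrix.of fun i j : Fin r =>
      if i ∈ S then (if j ∈ T then p i j else 0) else (if j ∈ T then 0 else q i j)).det ≠ 0) :
    (Matrix.of fun i j : Fin r => C (p i j) * X ^ d i j + C (q i j) * X ^ c₀ : Matrix (Fin r) (Fin r) ℂ[X]).det ≠ 0 := by
  classical
  set A : Matrix (Fin r) (Fin r) ℂ[X] :=
    Matrix.of fun i j : Fin r => C (p i j) * X ^ d i j + C (q i j) * X ^ c₀ with hA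
  set G : Matrix (Fin r) (Fin r) ℂ := Matrix.of fun i j : Fin r =>
      if i ∈ S then (if j ∈ T then p i j else 0) else (if j ∈ T then 0 else q i j) with hG'
  -- the X^N-coefficient of each Leibniz term
  have hterm : ∀ σ : Equiv.Perm (Fin r), (∏ j, A (σ j) j).coeff N = ∏ j, G (σ j) j := by
    intro σ
    by_cases hσ : ∀ j, σ j ∈ S ↔ j ∈ T
    · rw [← htop_eq σ hσ, coeff_prod_of_natDegree_le_sum _ _ _ (fun j _ => by
        simp only [hA, Matrix.of_apply]; exact natDegree_entry_le _ _ _ _)]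
      refine Finset.prod_congr rfl fun j _ => ?_
      simp only [hA, hG', Matrix.of_apply]
      rw [coeff_entry_max _ _ _ _ (hd _ _)]
      by_cases hj : σ j ∈ S
      · rw [if_pos ((hdS _ _).mpr hj), if_pos hj, if_pos ((hσ j).mp hj)]
      · rw [if_neg (fun h' => hj ((hdS _ _).mp h')), if_neg hj, if_neg (fun h' => hj ((hσ j).mpr h'))]
    · -- degree too small on the left, a zero factor on the right
      have hdeg : (∏ j, A (σ j) j).natDegree < N :=
        lt_of_le_of_lt ((natDegree_prod_le _ _).trans (Finset.sum_le_sum fun j _ => by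
          simp only [hA, Matrix.of_apply]; exact natDegree_entry_le _ _ _ _)) (htop_lt σ hσ)
      rw [coeff_eq_zero_of_natDegree_lt hdeg]
      obtain ⟨j, hj⟩ := not_forall.mp hσ
      symm
      apply Finset.prod_eq_zero (Finset.mem_univ j)
      simp only [hG', Matrix.of_apply]
      by_cases h1 : σ j ∈ S
      · rw [if_pos h1, if_neg (fun h2 => hj (iff_of_true h1 h2))]
      · rw [if_neg h1, if_pos (by by_contra h2; exact hj (iff_of_false h1 h2))]
  have hsignterm : ∀ σ : Equiv.Perm (Fin r),
      ((((Equiv.Perm.sign σ : ℤˣ) : ℤ) : ℂ[X]) * ∏ j, A (σ j) j).coeff N =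
        (((Equiv.Perm.sign σ : ℤˣ) : ℤ) : ℂ) * ∏ j, G (σ j) j := by
    intro σ
    rw [← C_eq_intCast, coeff_C_mul, hterm]
  -- the X^N-coefficient of det A is det G
  have hcoeff : (A.det).coeff N = G.det := by
    rw [Matrix.det_apply', Matrix.det_apply', finsetSum_coeff]
    exact Finset.sum_congr rfl fun σ _ => hsignterm σ
  intro hdet
  apply hG
  rw [← hcoeff, hdet, coeff_zero]

end Summit.ValiantsHypothesis.ValiantsHypothesis.Theorems.BarrierLever.TwoBlock
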